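import Summits.HodgeConjecture.HodgeConjecture.Theorems.Q8SymplecticPowersMatchingClassesAlgebraic
import Literature.AlgebraicGeometry.HodgeTheory.LefschetzOneOneHolds
import HarnessLib

/-!
# Route `Q8SymplecticPowers`, programme K2Q ∕ F-Q — brick A-Q′: **Künneth insertions of the QUATERNIONIC matching tensors
# (pairs tagged by `T`-projected graph Casimirs, free slots carrying Hodge classes) are algebraic**

Support file for crux K2Q `PowersHodgeOfQuaternionCommutators` (stmt-HodgeConjecture-24191; `--supports … --as helper`;
nothing here closes an item). Prover seat `hodge-nonav-20241-p1` (g21).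

Brick A-Q (`Q8SymplecticPowersMatchingClassesAlgebraic`, p706844) treats pair matrices `[σ^*]_b G⁻¹` (graph Casimirs).  The
all-powers stub `stub_higherPowersQ` produces (brick F2c-2) pair matrices `P (0 ⊕ [σ^*|_T]_{bT} G_T⁻¹) Pᵀ` — the graph
Casimir of `σ` PROJECTED TO THE TRANSCENDENTAL PART `T = Hdg¹^⊥` of `H²(X; ℚ)` (`bN ⊔ bT` an adapted basis of
`H² = N ⊕ T`, `N = Hdg¹`, `P` its matrix in `b = Module.finBasis`, `G_T` the Gram matrix of `tr ∘ cup` on `bT`) — and free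
slots carrying classes of `N`.  **`projectedMatchingClassesAlgebraic_of_fulton`**: their Künneth insertions are algebraic.

* §1 bilinear bookkeeping (`sum_sum_mul_transpose_smul`: `Σ (PMPᵀ)_{ii'} B(bᵢ, bᵢ') = Σ M_{ss'} B(v_s, v_{s'})` for
  `v_s = Σᵢ P_{is} bᵢ`; sums over `ιN ⊕ ιT` against block matrices; the inverse of a block-diagonal matrix);
* §2 **`ofRatClass_casimirT_mem_algebraicClasses`** — the `T`-Casimir `κ_T = Σ (G_T⁻¹)_{tt'} pr₁^*bT_t ∪ pr₂^*bT_{t'}` on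
  `X × X` is algebraic: the full Casimir in the adapted basis (`ofRatClass_casimir_mem_algebraicClasses`, the middle Künneth
  component of the diagonal; `b₁ = 0`) splits as `κ_N + κ_T` (`N ⊥ T`, block-diagonal Gram matrix), and `κ_N` is a
  combination of `pr₁^*n ∪ pr₂^*n'`, `n, n' ∈ Hdg¹` algebraic by Lefschetz `(1,1)` and Fulton's pull-back fact;
* §3 the brick: absorbing `[σ^*|_T]` into the first slot (`sum_toMatrix_mul_smul_eq` on `T`) turns the two-slot insertion of
  a projected pair matrix into `(f ≫ σ, g)^* κ_T`, algebraic by §2; the free slots are Hodge classes of `H²`, algebraic by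
  Lefschetz `(1,1)`; the free-slot re-summation `ofRatClass_sum_smul_cupChain_free_mem_algebraicClasses` (route A) finishes.
  `projectedMatchingClassesAlgebraic` discharges the Fulton binder (`fulton1998_map_mem_algebraicClasses_holds`).

HONEST FRAMING: axioms standard; item 24191 OPEN; nothing here says HC ∕ HC_CM ∕ HC_AV is proved.

## References

* C. Voisin, *Hodge Theory and Complex Algebraic Geometry I* (2002), §11.3.3 Thm. 11.38, Lemma 11.41, Thm. 11.30.
  [cite: VoisinHodgeI2002]
* C. Voisin, *Hodge Theory and Complex Algebraic Geometry II* (2003), proof of Prop. 9.20, Prop. 9.21 (i). [cite: VoisinHodgeII2003]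
* W. Fulton, *Intersection Theory* (1998), §19.2 Cor. 19.2 (b). [cite: Fulton1998]
-/

set_option linter.dupNamespace false

noncomputable section

open Finset
open CategoryTheory CategoryTheory.Limits MonoidalCategory CartesianMonoidalCategory
open Literature.AlgebraicGeometry.Motives Literature.AlgebraicGeometry.HodgeTheory
open Literature.AlgebraicGeometry.HodgeTheory.BettiUniverse
open Summit.HodgeConjecture.HodgeConjecture.Theorems.SignSymmetricPowersMatchingClassesAlgebraic
  (sum_smul_bettiCup_pull_eq_pull_lift sum_toMatrix_mul_smul_eq)
open Summit.HodgeConjecture.HodgeConjecture.Theorems.CyclicUnitaryPowersCupChainFreeSlots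
  (ofRatClass_sum_smul_cupChain_free_mem_algebraicClasses)
open Summit.HodgeConjecture.HodgeConjecture.Theorems.Q8SymplecticPowersSummandHodgeNormalForm
  (subsingleton_bettiCohomology_of_odd_of_b₁)
open scoped BigOperators Matrix TensorProduct

namespace Summit.HodgeConjecture.HodgeConjecture.Theorems.Q8SymplecticPowersProjectedMatchingClassesAlgebraic

/-! ### §1 Bilinear bookkeeping -/

section Bilinear

variable {V W : Type*} [AddCommGroup V] [Module ℚ V] [AddCommGroup W] [Module ℚ W]

omit [Module ℚ W] in
/-- Reordering a fourfold sum. [folklore] -/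
theorem sum4_comm {ι κ : Type*} [Fintype ι] [Fintype κ] (F : ι → ι → κ → κ → W) :
    ∑ i, ∑ i', ∑ s', ∑ s, F i i' s' s = ∑ s, ∑ s', ∑ i, ∑ i', F i i' s' s := by
  calc ∑ i, ∑ i', ∑ s', ∑ s, F i i' s' s
      = ∑ i, ∑ i', ∑ s, ∑ s', F i i' s' s :=
        Finset.sum_congr rfl fun i _ => Finset.sum_congr rfl fun i' _ => Finset.sum_comm
    _ = ∑ i, ∑ s, ∑ i', ∑ s', F i i' s' s := Finset.sum_congr rfl fun i _ => Finset.sum_comm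
    _ = ∑ s, ∑ i, ∑ i', ∑ s', F i i' s' s := Finset.sum_comm
    _ = ∑ s, ∑ i, ∑ s', ∑ i', F i i' s' s :=
        Finset.sum_congr rfl fun s _ => Finset.sum_congr rfl fun i _ => Finset.sum_comm
    _ = ∑ s, ∑ s', ∑ i, ∑ i', F i i' s' s := Finset.sum_congr rfl fun s _ => Finset.sum_comm

/-- `Σ_{i,i'} (P M Pᵀ)_{i i'} B(bᵢ, b_{i'}) = Σ_{s,s'} M_{s s'} B(v_s, v_{s'})` with `v_s = Σᵢ P_{i s} bᵢ` (bilinearity).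
[cite: VoisinHodgeI2002, §11.3.3 Lemma 11.41] -/
theorem sum_sum_mul_transpose_smul {ι κ : Type*} [Fintype ι] [Fintype κ] (P : Matrix ι κ ℚ) (M : Matrix κ κ ℚ)
    (b : ι → V) (B₂ : V →ₗ[ℚ] V →ₗ[ℚ] W) :
    ∑ i, ∑ i', (P * M * Pᵀ) i i' • B₂ (b i) (b i') = ∑ s, ∑ s', M s s' • B₂ (∑ i, P i s • b i) (∑ i', P i' s' • b i') := by
  have hL : ∀ i i', (P * M * Pᵀ) i i' • B₂ (b i) (b i') = ∑ s', ∑ s, (P i s * M s s' * P i' s') • B₂ (b i) (b i') := by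
    intro i i'
    rw [Matrix.mul_apply, Finset.sum_smul]
    refine Finset.sum_congr rfl fun s' _ => ?_
    rw [Matrix.mul_apply, Finset.sum_mul, Finset.sum_smul, Matrix.transpose_apply]
  have hR : ∀ s s', M s s' • B₂ (∑ i, P i s • b i) (∑ i', P i' s' • b i') =
      ∑ i, ∑ i', (P i s * M s s' * P i' s') • B₂ (b i) (b i') := by
    intro s s'
    rw [map_sum B₂, LinearMap.sum_apply, Finset.smul_sum]
    refine Finset.sum_congr rfl fun i _ => ?_
    rw [map_smul B₂, LinearMap.smul_apply, map_sum (B₂ (b i)), Finset.smul_sum, Finset.smul_sum]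
    refine Finset.sum_congr rfl fun i' _ => ?_
    rw [map_smul (B₂ (b i)), smul_smul, smul_smul]
    congr 1
    ring
  simp only [hL, hR]
  exact sum4_comm fun i i' s' s => (P i s * M s s' * P i' s') • B₂ (b i) (b i')

/-- A double sum over `ιN ⊕ ιT` against `fromBlocks 0 0 0 D` only sees the `T`-block. [folklore] -/
theorem sum_sum_fromBlocks_zero_smul {ιN ιT : Type*} [Fintype ιN] [Fintype ιT] (D : Matrix ιT ιT ℚ)
    (F : ιN ⊕ ιT → ιN ⊕ ιT → W) :
    ∑ s, ∑ s', (Matrix.fromBlocks (0 : Matrix ιN ιN ℚ) 0 0 D) s s' • F s s' = ∑ t, ∑ t', D t t' • F (Sum.inr t) (Sum.inr t') := by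
  rw [Fintype.sum_sum_type]
  simp only [Fintype.sum_sum_type, Matrix.fromBlocks_apply₁₁, Matrix.fromBlocks_apply₁₂, Matrix.fromBlocks_apply₂₁,
    Matrix.fromBlocks_apply₂₂, Matrix.zero_apply, zero_smul, Finset.sum_const_zero, zero_add]

/-- A double sum over `ιN ⊕ ιT` against `fromBlocks A 0 0 D` is the `N`-block sum plus the `T`-block sum. [folklore] -/
theorem sum_sum_fromBlocks_diag_smul {ιN ιT : Type*} [Fintype ιN] [Fintype ιT] (A : Matrix ιN ιN ℚ) (D : Matrix ιT ιT ℚ)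
    (F : ιN ⊕ ιT → ιN ⊕ ιT → W) :
    ∑ s, ∑ s', (Matrix.fromBlocks A 0 0 D) s s' • F s s' =
      (∑ k, ∑ k', A k k' • F (Sum.inl k) (Sum.inl k')) + ∑ t, ∑ t', D t t' • F (Sum.inr t) (Sum.inr t') := by
  rw [Fintype.sum_sum_type]
  simp only [Fintype.sum_sum_type, Matrix.fromBlocks_apply₁₁, Matrix.fromBlocks_apply₁₂, Matrix.fromBlocks_apply₂₁,
    Matrix.fromBlocks_apply₂₂, Matrix.zero_apply, zero_smul, Finset.sum_const_zero, zero_add, add_zero]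

/-- The inverse of an invertible block-diagonal matrix. [folklore] -/
theorem inv_fromBlocks_diag {ιN ιT : Type*} [Fintype ιN] [Fintype ιT] [DecidableEq ιN] [DecidableEq ιT]
    (A : Matrix ιN ιN ℚ) (D : Matrix ιT ιT ℚ) (hA : IsUnit A.det) (hD : IsUnit D.det) :
    (Matrix.fromBlocks A 0 0 D)⁻¹ = Matrix.fromBlocks A⁻¹ 0 0 D⁻¹ :=
  Matrix.inv_eq_left_inv (by
    rw [Matrix.fromBlocks_multiply]
    simp only [Matrix.mul_zero, Matrix.zero_mul, add_zero, zero_add, Matrix.nonsing_inv_mul _ hA,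
      Matrix.nonsing_inv_mul _ hD, Matrix.fromBlocks_one])

end Bilinear

/-! ### §2 The `T`-Casimir on `X × X` is algebraic -/

variable {X Y : SchemeOver ℂ}

/-- **Hodge classes of `H²` of a surface are algebraic** (Lefschetz `(1,1)`, rational form). [cite: VoisinHodgeI2002, Thm. 11.30] -/
theorem ofRatClass_mem_algebraicClasses_of_mem_hodgeClasses (hX : IsSmoothProjective 2 X) {z : bettiCohomology X 2}
    (hz : z ∈ (hodge exists_isReal_hodgeModel_holds hX 2).hodgeClasses 1) :
    ofRatClass (ComplexPoints X) (2 * 1) z ∈ algebraicClasses X 1 := by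
  have hT : IsOfHodgeType 2 X (2 * 1) 1 1 (ofRatClass (ComplexPoints X) (2 * 1) z) :=
    (HodgeModel.mem_hodgeClasses_iff_isOfHodgeType (realHodgeModel exists_isReal_hodgeModel_holds hX) hX
      hodgePQ_independent_of_hodgeModel_holds (realHodgeModel_isHodgeSymmetric exists_isReal_hodgeModel_holds hX)
      1 z).1 hz
  have hrat : IsRationalClass (ofRatClass (ComplexPoints X) (2 * 1) z) :=
    (isRationalClass_iff_mem_range_ofRatClass _).2 ⟨z, rfl⟩
  exact lefschetzOneOne_rational_holds hX _ hrat hT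

/-- **The `T`-Casimir is algebraic.** For a smooth projective surface `X` with `b₁ = 0`, `H²(X; ℚ) = N ⊕ T` with
`N ⊆ Hdg¹`, `tr(N ∪ T) = 0 = tr(T ∪ N)`, bases `bN, bT` with `tr ∘ cup` nondegenerate on both: the class
`Σ_{t,t'} (G_T⁻¹)_{t t'} pr₁^* bT_t ∪ pr₂^* bT_{t'}` on `X × X` has algebraic complexification.
[cite: VoisinHodgeI2002, §11.3.3 Thm. 11.38 and Thm. 11.30] [cite: Fulton1998, §19.2 Cor. 19.2 (b)] -/
theorem ofRatClass_casimirT_mem_algebraicClasses (hP : fulton1998_map_mem_algebraicClasses)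
    (hX : IsSmoothProjective 2 X) (hb1 : Module.finrank ℚ (bettiCohomology X 1) = 0)
    {N T : Submodule ℚ (bettiCohomology X 2)} (hNT : IsCompl N T)
    (hN : ∀ x ∈ N, x ∈ (hodge exists_isReal_hodgeModel_holds hX 2).hodgeClasses 1)
    (horth : ∀ n ∈ N, ∀ t ∈ T, tr hX (2 + 2) (cup X 2 2 n t) = 0)
    (horth' : ∀ t ∈ T, ∀ n ∈ N, tr hX (2 + 2) (cup X 2 2 t n) = 0)
    {nN nT : ℕ} (bN : Module.Basis (Fin nN) ℚ N) (bT : Module.Basis (Fin nT) ℚ T)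
    (hGN : IsUnit (Matrix.of fun k k' : Fin nN => tr hX (2 + 2) (cup X 2 2 (bN k : bettiCohomology X 2) (bN k'))).det)
    (hGT : IsUnit (Matrix.of fun k k' : Fin nT => tr hX (2 + 2) (cup X 2 2 (bT k : bettiCohomology X 2) (bT k'))).det) :
    ofRatClass (ComplexPoints (X ⊗ X)) (2 * 2)
      (∑ t, ∑ t', (Matrix.of fun k k' : Fin nT => tr hX (2 + 2) (cup X 2 2 (bT k : bettiCohomology X 2) (bT k')))⁻¹ t t' •
        bettiCup (rfl : 2 + 2 = 2 * 2) (pull (fst X X) 2 (bT t : bettiCohomology X 2)) (pull (snd X X) 2 (bT t'))) ∈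
      algebraicClasses (X ⊗ X) 2 := by
  classical
  have hXX : IsSmoothProjective (2 + 2) (X ⊗ X) := hX.tensor_holds hX
  have h2 : 2 + 2 = 2 * 2 := rfl
  -- the adapted basis
  let bA : Module.Basis (Fin nN ⊕ Fin nT) ℚ (bettiCohomology X 2) := (bN.prod bT).map (Submodule.prodEquivOfIsCompl N T hNT)
  have hbA : ∀ s, bA s = Sum.elim (fun k => (bN k : bettiCohomology X 2)) (fun k => (bT k : bettiCohomology X 2)) s := by
    intro s
    rcases s with k | k
    · show (Submodule.prodEquivOfIsCompl N T hNT) ((bN.prod bT) (Sum.inl k)) = _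
      rw [Module.Basis.prod_apply, Sum.elim_inl, Function.comp_apply, LinearMap.inl_apply, Submodule.coe_prodEquivOfIsCompl',
        Submodule.coe_zero, add_zero, Sum.elim_inl]
    · show (Submodule.prodEquivOfIsCompl N T hNT) ((bN.prod bT) (Sum.inr k)) = _
      rw [Module.Basis.prod_apply, Sum.elim_inr, Function.comp_apply, LinearMap.inr_apply, Submodule.coe_prodEquivOfIsCompl',
        Submodule.coe_zero, zero_add, Sum.elim_inr]
  set GN : Matrix (Fin nN) (Fin nN) ℚ :=
    Matrix.of fun k k' : Fin nN => tr hX (2 + 2) (cup X 2 2 (bN k : bettiCohomology X 2) (bN k')) with hGNdef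
  set GT : Matrix (Fin nT) (Fin nT) ℚ :=
    Matrix.of fun k k' : Fin nT => tr hX (2 + 2) (cup X 2 2 (bT k : bettiCohomology X 2) (bT k')) with hGTdef
  -- its Gram matrix is block diagonal
  have hGram : (Matrix.of fun s s' => ((cup X 2 2).compr₂ (tr hX (2 + 2))) (bA s) (bA s')) = Matrix.fromBlocks GN 0 0 GT := by
    ext s s'
    rw [Matrix.of_apply, LinearMap.compr₂_apply, hbA, hbA]
    rcases s with k | k <;> rcases s' with k' | k'
    · rw [Matrix.fromBlocks_apply₁₁, Sum.elim_inl, Sum.elim_inl, hGNdef, Matrix.of_apply]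
    · rw [Matrix.fromBlocks_apply₁₂, Sum.elim_inl, Sum.elim_inr, Matrix.zero_apply]
      exact horth _ (bN k).2 _ (bT k').2
    · rw [Matrix.fromBlocks_apply₂₁, Sum.elim_inr, Sum.elim_inl, Matrix.zero_apply]
      exact horth' _ (bT k).2 _ (bN k').2
    · rw [Matrix.fromBlocks_apply₂₂, Sum.elim_inr, Sum.elim_inr, hGTdef, Matrix.of_apply]
  -- the full Casimir in the adapted basis is algebraic
  have hκ := ofRatClass_casimir_mem_algebraicClasses hX
    (fun j hj hjn ↦ subsingleton_bettiCohomology_of_odd_of_b₁ hX hb1 hj hjn)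
    (fun a z' ha ↦ by
      rw [algebraicClasses_eq_top_of_eq_zero_or_le hX (by omega)]
      exact Submodule.mem_top) bA h2
  rw [hGram, inv_fromBlocks_diag GN GT hGN hGT, sum_sum_fromBlocks_diag_smul] at hκ
  simp only [hbA, Sum.elim_inl, Sum.elim_inr] at hκ
  -- the `N`-part is algebraic
  have hκN : ofRatClass (ComplexPoints (X ⊗ X)) (2 * 2)
      (∑ k, ∑ k', GN⁻¹ k k' • bettiCup h2 (pull (fst X X) 2 (bN k : bettiCohomology X 2)) (pull (snd X X) 2 (bN k'))) ∈
      algebraicClasses (X ⊗ X) 2 := by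
    rw [map_sum]
    refine Submodule.sum_mem _ fun k _ => ?_
    rw [map_sum]
    refine Submodule.sum_mem _ fun k' _ => ?_
    rw [Literature.AlgebraicGeometry.Motives.ofRatClass_smul]
    refine Submodule.smul_mem _ _ ?_
    exact ofRatClass_bettiCup_mem_algebraicClasses hP hXX (show 2 * 1 + 2 * 1 = 2 * 2 from rfl)
      (ofRatClass_pull_mem_algebraicClasses hP hX hXX (fst X X)
        (ofRatClass_mem_algebraicClasses_of_mem_hodgeClasses hX (hN _ (bN k).2)))
      (ofRatClass_pull_mem_algebraicClasses hP hX hXX (snd X X)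
        (ofRatClass_mem_algebraicClasses_of_mem_hodgeClasses hX (hN _ (bN k').2)))
  -- hence the `T`-part
  rw [map_add] at hκ
  have h := Submodule.sub_mem _ hκ hκN
  rwa [add_sub_cancel_left] at h

/-! ### §3 The brick -/

/-- **Brick A-Q′, Fulton's fact as a hypothesis.** For a smooth projective surface `X` with `b₁ = 0`, `H² = N ⊕ T` with
`N ⊆ Hdg¹` orthogonal to `T` for `tr ∘ cup` (nondegenerate on bases `bN`, `bT`), a limit fan `(Y, π)` of copies of `X`, a
decoration `wdec` with algebraic complexification, a Künneth insertion `E` given on basis tensors of `b = Module.finBasis` by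
the cup chain `wdec ∪ π_{u 0}^* b_{w 0} ∪ ⋯`, a matching `ε` whose pairs are tagged by self-maps `g c : X ⟶ X` preserving `T` and
whose free slots carry classes `z a ∈ N`: the insertion under `E` of the quaternionic matching tensor with pair matrices
`P (0 ⊕ [(g c)^*|_T]_{bT} G_T⁻¹) Pᵀ` (`P` the matrix of `bN ⊔ bT` in `b`) and free vectors `b.repr (z a)` has algebraic
complexification on `Y`. [cite: VoisinHodgeI2002, §11.3.3 Thm. 11.38, Lemma 11.41 and Thm. 11.30]
[cite: VoisinHodgeII2003, proof of Prop. 9.20 and Prop. 9.21 (i)] [cite: Fulton1998, §19.2 Cor. 19.2 (b)] -/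
theorem projectedMatchingClassesAlgebraic_of_fulton (hP : fulton1998_map_mem_algebraicClasses)
    (hX : IsSmoothProjective 2 X) (hb1 : Module.finrank ℚ (bettiCohomology X 1) = 0)
    [Module.Finite ℚ (bettiCohomology X 2)]
    {k : ℕ} (π : Fin (k + 1) → (Y ⟶ X)) (hlim : IsLimit (Fan.mk Y π)) (q q' r : ℕ) (u : Fin r → Fin (k + 1))
    (wdec : bettiCohomology Y (2 * q')) (hwdec : ofRatClass (ComplexPoints Y) (2 * q') wdec ∈ algebraicClasses Y q')
    (E : hodgeTensorSpace (bettiCohomology X 2) r 0 →ₗ[ℚ] bettiCohomology Y (2 * q))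
    (hE : ∀ w : Fin r → Fin (Module.finrank ℚ (bettiCohomology X 2)),
      (⟨2 * q, E ((PiTensorProduct.tprod ℚ fun i => (Module.finBasis ℚ (bettiCohomology X 2)) (w i)) ⊗ₜ[ℚ]
        (PiTensorProduct.tprod ℚ fun i : Fin 0 => (Fin.elim0 i : Module.Dual ℚ (bettiCohomology X 2))))⟩ :
        Σ n, bettiCohomology Y n) =
      List.foldl (fun (acc : Σ n, bettiCohomology Y n) (i : Fin r) =>
        ⟨acc.1 + 2, cup Y acc.1 2 acc.2 (pull (π (u i)) 2 ((Module.finBasis ℚ (bettiCohomology X 2)) (w i)))⟩)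
        ⟨2 * q', wdec⟩ (List.finRange r))
    {N T : Submodule ℚ (bettiCohomology X 2)} (hNT : IsCompl N T)
    (hN : ∀ x ∈ N, x ∈ (hodge exists_isReal_hodgeModel_holds hX 2).hodgeClasses 1)
    (horth : ∀ n ∈ N, ∀ t ∈ T, tr hX (2 + 2) (cup X 2 2 n t) = 0)
    (horth' : ∀ t ∈ T, ∀ n ∈ N, tr hX (2 + 2) (cup X 2 2 t n) = 0)
    {nN nT : ℕ} (bN : Module.Basis (Fin nN) ℚ N) (bT : Module.Basis (Fin nT) ℚ T)
    (hGN : IsUnit (Matrix.of fun k k' : Fin nN => tr hX (2 + 2) (cup X 2 2 (bN k : bettiCohomology X 2) (bN k'))).det)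
    (hGT : IsUnit (Matrix.of fun k k' : Fin nT => tr hX (2 + 2) (cup X 2 2 (bT k : bettiCohomology X 2) (bT k'))).det)
    (j l : ℕ) (ε : Fin r ≃ (Fin 2 × Fin j) ⊕ Fin l) (g : Fin j → (X ⟶ X)) (hgT : ∀ c, ∀ x ∈ T, pull (g c) 2 x ∈ T)
    (z : Fin l → bettiCohomology X 2) (hz : ∀ a, z a ∈ N) :
    ofRatClass (ComplexPoints Y) (2 * q) (E (∑ w : Fin r → Fin (Module.finrank ℚ (bettiCohomology X 2)),
      ((∏ c : Fin j,
          ((Matrix.of fun i s => Sum.elim (fun k => (Module.finBasis ℚ (bettiCohomology X 2)).repr (bN k : bettiCohomology X 2) i)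
              (fun k => (Module.finBasis ℚ (bettiCohomology X 2)).repr (bT k : bettiCohomology X 2) i) s) *
            Matrix.fromBlocks (0 : Matrix (Fin nN) (Fin nN) ℚ) 0 0
              (LinearMap.toMatrix bT bT ((pull (g c) 2).restrict (hgT c)) *
                (Matrix.of fun k k' : Fin nT => tr hX (2 + 2) (cup X 2 2 (bT k : bettiCohomology X 2) (bT k')))⁻¹) *
            (Matrix.of fun i s => Sum.elim (fun k => (Module.finBasis ℚ (bettiCohomology X 2)).repr (bN k : bettiCohomology X 2) i)
              (fun k => (Module.finBasis ℚ (bettiCohomology X 2)).repr (bT k : bettiCohomology X 2) i) s)ᵀ)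
            (w (ε.symm (Sum.inl (0, c)))) (w (ε.symm (Sum.inl (1, c))))) *
        ∏ a : Fin l, ((Module.finBasis ℚ (bettiCohomology X 2)).repr (z a)) (w (ε.symm (Sum.inr a)))) •
      ((PiTensorProduct.tprod ℚ fun i => (Module.finBasis ℚ (bettiCohomology X 2)) (w i)) ⊗ₜ[ℚ]
        (PiTensorProduct.tprod ℚ fun i : Fin 0 => (Fin.elim0 i : Module.Dual ℚ (bettiCohomology X 2)))))) ∈
      algebraicClasses Y q := by
  classical
  have hY : IsSmoothProjective (2 * (k + 1)) Y := isSmoothProjective_of_isLimit_fan hX π hlim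
  have hXX : IsSmoothProjective (2 + 2) (X ⊗ X) := hX.tensor_holds hX
  have h2 : 2 + 2 = 2 * 2 := rfl
  set b := Module.finBasis ℚ (bettiCohomology X 2) with hb
  set GT : Matrix (Fin nT) (Fin nT) ℚ :=
    Matrix.of fun k k' : Fin nT => tr hX (2 + 2) (cup X 2 2 (bT k : bettiCohomology X 2) (bT k')) with hGTdef
  set P : Matrix (Fin (Module.finrank ℚ (bettiCohomology X 2))) (Fin nN ⊕ Fin nT) ℚ :=
    Matrix.of fun i s => Sum.elim (fun k => b.repr (bN k : bettiCohomology X 2) i)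
      (fun k => b.repr (bT k : bettiCohomology X 2) i) s with hPdef
  -- the `T`-vectors of the adapted family in coordinates
  have hvT : ∀ k, ∑ i, P i (Sum.inr k) • b i = (bT k : bettiCohomology X 2) := by
    intro k
    simp only [hPdef, Matrix.of_apply, Sum.elim_inr]
    exact b.sum_repr _
  -- the `T`-Casimir on `X × X` is algebraic (§2)
  have hκT := ofRatClass_casimirT_mem_algebraicClasses hP hX hb1 hNT hN horth horth' bN bT hGN hGT
  -- the two-slot insertions of the projected pair matrices are algebraic
  have hΘ : ∀ (mm : Fin j) (f' g' : Y ⟶ X), ofRatClass (ComplexPoints Y) (2 * 2)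
      (∑ i, ∑ i', (P * Matrix.fromBlocks (0 : Matrix (Fin nN) (Fin nN) ℚ) 0 0
          (LinearMap.toMatrix bT bT ((pull (g mm) 2).restrict (hgT mm)) * GT⁻¹) * Pᵀ) i i' •
        bettiCup h2 (pull f' 2 (b i)) (pull g' 2 (b i'))) ∈ algebraicClasses Y 2 := by
    intro mm f' g'
    have hPM := sum_sum_mul_transpose_smul P (Matrix.fromBlocks (0 : Matrix (Fin nN) (Fin nN) ℚ) 0 0
      (LinearMap.toMatrix bT bT ((pull (g mm) 2).restrict (hgT mm)) * GT⁻¹)) b ((bettiCup h2).compl₁₂ (pull f' 2) (pull g' 2))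
    rw [sum_sum_fromBlocks_zero_smul] at hPM
    simp only [LinearMap.compl₁₂_apply, hvT] at hPM
    rw [hPM]
    -- absorb `[(g mm)^*|_T]` into the first slot, on `T`
    have habs := sum_toMatrix_mul_smul_eq (V := T) bT ((pull (g mm) 2).restrict (hgT mm)) GT⁻¹
      (((bettiCup h2).compl₁₂ (pull f' 2) (pull g' 2)).compl₁₂ T.subtype T.subtype)
    simp only [LinearMap.compl₁₂_apply, Submodule.subtype_apply, LinearMap.coe_restrict_apply] at habs
    rw [habs]
    have hg : ∀ x : bettiCohomology X 2, pull f' 2 (pull (g mm) 2 x) = pull (f' ≫ g mm) 2 x := fun x ↦ by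
      rw [pull_comp f' (g mm) 2, LinearMap.comp_apply]
    simp only [hg]
    rw [sum_smul_bettiCup_pull_eq_pull_lift h2]
    exact ofRatClass_pull_mem_algebraicClasses hP hXX hY (lift (f' ≫ g mm) g') hκT
  -- the free slots carry Hodge classes, algebraic by Lefschetz `(1,1)`
  have hc : ∀ a : Fin l, ofRatClass (ComplexPoints X) (2 * 1) (∑ i, (b.repr (z a)) i • b i) ∈ algebraicClasses X 1 := by
    intro a
    rw [b.sum_repr (z a)]
    exact ofRatClass_mem_algebraicClasses_of_mem_hodgeClasses hX (hN _ (hz a))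
  -- the free-slot re-summation theorem
  rw [map_sum E]
  simp only [map_smul]
  exact ofRatClass_sum_smul_cupChain_free_mem_algebraicClasses hP hX hY 1 rfl b π u q' wdec hwdec q
    (fun w ↦ E ((PiTensorProduct.tprod ℚ fun i => b (w i)) ⊗ₜ[ℚ]
      (PiTensorProduct.tprod ℚ fun i : Fin 0 => (Fin.elim0 i : Module.Dual ℚ (bettiCohomology X 2)))))
    hE ε (fun mm i i' ↦ (P * Matrix.fromBlocks (0 : Matrix (Fin nN) (Fin nN) ℚ) 0 0
          (LinearMap.toMatrix bT bT ((pull (g mm) 2).restrict (hgT mm)) * GT⁻¹) * Pᵀ) i i') hΘ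
    (fun a i ↦ (b.repr (z a)) i) hc

/-- **Brick A-Q′, unconditional** (Fulton binder discharged by `fulton1998_map_mem_algebraicClasses_holds`).
[cite: VoisinHodgeI2002, §11.3.3 Thm. 11.38 and Lemma 11.41] [cite: Fulton1998, §19.2 Cor. 19.2 (b)] -/
theorem projectedMatchingClassesAlgebraic
    (hX : IsSmoothProjective 2 X) (hb1 : Module.finrank ℚ (bettiCohomology X 1) = 0)
    [Module.Finite ℚ (bettiCohomology X 2)]
    {k : ℕ} (π : Fin (k + 1) → (Y ⟶ X)) (hlim : IsLimit (Fan.mk Y π)) (q q' r : ℕ) (u : Fin r → Fin (k + 1))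
    (wdec : bettiCohomology Y (2 * q')) (hwdec : ofRatClass (ComplexPoints Y) (2 * q') wdec ∈ algebraicClasses Y q')
    (E : hodgeTensorSpace (bettiCohomology X 2) r 0 →ₗ[ℚ] bettiCohomology Y (2 * q))
    (hE : ∀ w : Fin r → Fin (Module.finrank ℚ (bettiCohomology X 2)),
      (⟨2 * q, E ((PiTensorProduct.tprod ℚ fun i => (Module.finBasis ℚ (bettiCohomology X 2)) (w i)) ⊗ₜ[ℚ]
        (PiTensorProduct.tprod ℚ fun i : Fin 0 => (Fin.elim0 i : Module.Dual ℚ (bettiCohomology X 2))))⟩ :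
        Σ n, bettiCohomology Y n) =
      List.foldl (fun (acc : Σ n, bettiCohomology Y n) (i : Fin r) =>
        ⟨acc.1 + 2, cup Y acc.1 2 acc.2 (pull (π (u i)) 2 ((Module.finBasis ℚ (bettiCohomology X 2)) (w i)))⟩)
        ⟨2 * q', wdec⟩ (List.finRange r))
    {N T : Submodule ℚ (bettiCohomology X 2)} (hNT : IsCompl N T)
    (hN : ∀ x ∈ N, x ∈ (hodge exists_isReal_hodgeModel_holds hX 2).hodgeClasses 1)
    (horth : ∀ n ∈ N, ∀ t ∈ T, tr hX (2 + 2) (cup X 2 2 n t) = 0)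
    (horth' : ∀ t ∈ T, ∀ n ∈ N, tr hX (2 + 2) (cup X 2 2 t n) = 0)
    {nN nT : ℕ} (bN : Module.Basis (Fin nN) ℚ N) (bT : Module.Basis (Fin nT) ℚ T)
    (hGN : IsUnit (Matrix.of fun k k' : Fin nN => tr hX (2 + 2) (cup X 2 2 (bN k : bettiCohomology X 2) (bN k'))).det)
    (hGT : IsUnit (Matrix.of fun k k' : Fin nT => tr hX (2 + 2) (cup X 2 2 (bT k : bettiCohomology X 2) (bT k'))).det)
    (j l : ℕ) (ε : Fin r ≃ (Fin 2 × Fin j) ⊕ Fin l) (g : Fin j → (X ⟶ X)) (hgT : ∀ c, ∀ x ∈ T, pull (g c) 2 x ∈ T)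
    (z : Fin l → bettiCohomology X 2) (hz : ∀ a, z a ∈ N) :
    ofRatClass (ComplexPoints Y) (2 * q) (E (∑ w : Fin r → Fin (Module.finrank ℚ (bettiCohomology X 2)),
      ((∏ c : Fin j,
          ((Matrix.of fun i s => Sum.elim (fun k => (Module.finBasis ℚ (bettiCohomology X 2)).repr (bN k : bettiCohomology X 2) i)
              (fun k => (Module.finBasis ℚ (bettiCohomology X 2)).repr (bT k : bettiCohomology X 2) i) s) *
            Matrix.fromBlocks (0 : Matrix (Fin nN) (Fin nN) ℚ) 0 0
              (LinearMap.toMatrix bT bT ((pull (g c) 2).restrict (hgT c)) *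
                (Matrix.of fun k k' : Fin nT => tr hX (2 + 2) (cup X 2 2 (bT k : bettiCohomology X 2) (bT k')))⁻¹) *
            (Matrix.of fun i s => Sum.elim (fun k => (Module.finBasis ℚ (bettiCohomology X 2)).repr (bN k : bettiCohomology X 2) i)
              (fun k => (Module.finBasis ℚ (bettiCohomology X 2)).repr (bT k : bettiCohomology X 2) i) s)ᵀ)
            (w (ε.symm (Sum.inl (0, c)))) (w (ε.symm (Sum.inl (1, c))))) *
        ∏ a : Fin l, ((Module.finBasis ℚ (bettiCohomology X 2)).repr (z a)) (w (ε.symm (Sum.inr a)))) •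
      ((PiTensorProduct.tprod ℚ fun i => (Module.finBasis ℚ (bettiCohomology X 2)) (w i)) ⊗ₜ[ℚ]
        (PiTensorProduct.tprod ℚ fun i : Fin 0 => (Fin.elim0 i : Module.Dual ℚ (bettiCohomology X 2)))))) ∈
      algebraicClasses Y q :=
  projectedMatchingClassesAlgebraic_of_fulton
    Summit.HodgeConjecture.HodgeConjecture.Theorems.fulton1998_map_mem_algebraicClasses_holds hX hb1 π hlim q q' r u wdec
    hwdec E hE hNT hN horth horth' bN bT hGN hGT j l ε g hgT z hz

end Summit.HodgeConjecture.HodgeConjecture.Theorems.Q8SymplecticPowersProjectedMatchingClassesAlgebraic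

end
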